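import Summits.Ventures.Crystal3D.Theorems.StickyWulffConstantCoaxialWallLawReflectionWordsFrame
import Summits.Ventures.Crystal3D.Theorems.StickyWulffConstantCoaxialWallLawReducedWordRigidity
import HarnessLib

/-!
# `std_cases8`: the eight standard dozens as placement words, and the pulled-back letters
# (crux `CoaxialWallLaw`, stmt-Ventures-19481, line `WallLedgerF`; item (L1′) of MODULE-CAPTURE-PLAN v2 §6–§7)

HONEST FRAMING. Venture `Summits/Ventures/Crystal3D` (cell `crystal3d-full`), helper `--supports` the crux `CoaxialWallLaw`
of `route-Ventures-StickyWulffConstant` (REGISTERED line `WallLedgerF`, skeleton `Certificates` v3, registered stub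
`stub_moduleCapture`).  Item (L1′)(a)+(b) of HOME/wall-19481-p2/MODULE-CAPTURE-PLAN-g10.md v2 (cf-p1 (clvii)): the
EIGHT-dozen analogue of `std_cases` / `symm_axis_menu` / `image_basalMirror_fw` of `…ReducedWordRigidity`, the input of
19481-p2's `class_collapse8`.  Built on `…ReflectionWordsFrame` (`ReflWord.nrmVec/letterIso/wordIso`).  Rung credit only;
F-C1 not moved; census-free.

* `basalMirror_eq_letterIso` (`M_b = letterIso 0`), `reflectAt_inclinedNormal_eq` (`R_c = letterIso (c+1)`, `c < 3`),
  `inclinedNormal_natAdd` (`n_{3+c} = M_b n_c`), `image_reflectAt_natAdd_basalMirror` (`R_{3+c} (M_b D) = wordIso [c+1, 0] D`);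
* **`stdFrame_iff_exists_word`** — `StdFrame L₀ ↔ img L₀ = wordIso w '' fccSlots` for a PLACEMENT WORD
  `w ∈ 𝒮₀ = {[], [0], [c+1], [c+1, 0]}` (the dozens `D₊, D₋ = M_bD₊, R_cD₊, R_{c+3}D₋ = M_bR_cD₊`);
* `nrmVec_menu`, `isMenuNormal_nrmVec`, `inner_nrmVec_of_ne` — the letters are unit model menu normals at mutual `±1/3`;
  `symm_letterIso_apply`, `symm_wordIso_apply` — conjugation `O⁻¹ ∘ wordIso w ∘ O` = the model `foldl` mirror chain of the
  pulled-back letters `O⁻¹ nᵢ`; `symm_nrmVec_menu`, `isChain_map_symm_nrmVec`;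
* **`std_cases8`** — for STANDARD `G, G'`: `img G' = G '' (Φ_P '' fccSlots)` with `P` a reduced chain of `≤ 3` unit model menu
  normals (`P` = pull-back through `G` of `reduce (v ++ u.reverse)`, `u, v` the placement words; twin distance `≤ 3`,
  `length_reduce_placement`); **`std_cases8_fw`** — the plate-system form `img G' = img (S.Fw (P ++ κ₀))` for `G = S.Fw κ₀`;
* `isMenuNormal_of_image_eq_wordIso` — the `{111}` normals `wordIso u nᵢ` of a standard dozen are menu normals of its frames
  (the letters for the partner formula `image_reflection_fw` / `isMenuLetter_symm_of_isMenuNormal` of 19481-p2's `…MirrorPartner`).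
WHAT THIS IS NOT: not `class_collapse8` (19481-p2), not the partner formula (`…MirrorPartner`), not the stub; F-C1 not moved.
-/

noncomputable section

namespace Summit.Ventures.Crystal3D.Theorems

namespace ReflWord

open Summit.Ventures.Crystal3D Matrix NearIdentity TailResidue
open Literature.MathematicalPhysics.StatisticalMechanics (basalMirror)
open scoped InnerProductSpace

/-! ### The eight standard placements as words -/

/-- **The basal mirror of the literature is the letter `0`** (`M₀ = ⅓[[1,2,2],[2,1,−2],[2,−2,1]]` in cubic coordinates). -/
theorem basalMirror_eq_letterIso : basalMirror = letterIso 0 := by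
  ext x : 1
  apply cubicCoords_injective
  rw [cubicCoords_basalMirror, cubicCoords_letterIso]
  ext a
  fin_cases a <;>
    simp [Matrix.mulVec, dotProduct, Fin.sum_univ_three, M, nrmQ, nrm, vecMulVec_apply, Matrix.one_apply] <;> ring

/-- The inclined mirrors `0, 1, 2` of `…ReadingDirections` are the letters `1, 2, 3` (as maps). -/
theorem reflectAt_inclinedNormal_eq (c : Fin 3) :
    reflectAt (inclinedNormal (Fin.castLE (by norm_num) c)) 0 = ⇑(letterIso c.succ) := by
  rw [letterIso_succ, coe_inclIso]

/-- **The inclined normals of `D₋` are the basal-mirror images of those of `D₊`**: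
`inclinedNormal (3 + c) = basalMirror (inclinedNormal c)` (`c = 0, 1, 2`). -/
theorem inclinedNormal_natAdd (c : Fin 3) :
    inclinedNormal (Fin.natAdd 3 c) = basalMirror (inclinedNormal (Fin.castLE (by norm_num) c)) := by
  have key := sqrt6_inv_mul
  apply cubicCoords_injective
  rw [cubicCoords_basalMirror, cubicCoords_inclinedNormal c, inclinedNormal_eq, cubicCoords_smul, cubicCoords_fineVec]
  ext a
  fin_cases c <;> fin_cases a <;> simp [normFine, nrmR, nrm] <;>
    first
    | linear_combination (5 / 3 : ℝ) * key
    | linear_combination (1 / 3 : ℝ) * key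
    | linear_combination (-1 / 3 : ℝ) * key
    | linear_combination (-5 / 3 : ℝ) * key

/-- Conjugation by the basal mirror `B` (`B² = 1`): the mirror across `B n` maps `B x` to `B (mirror of x across n)`. -/
theorem reflectAt_basalMirror (n x : EuclideanSpace ℝ (Fin 3)) :
    reflectAt (basalMirror n) 0 (basalMirror x) = basalMirror (reflectAt n 0 x) := by
  simp only [reflectAt, sub_zero, LinearIsometryEquiv.inner_map_map, map_sub, LinearIsometryEquiv.map_smul]

/-- A one-letter word is the letter (as a map). -/
theorem coe_wordIso_singleton (i : Fin 4) :
    ⇑(wordIso [i]) = ⇑(letterIso i) := by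
  rw [wordIso_cons, wordIso_nil, LinearIsometryEquiv.trans_refl]

/-- A two-letter word (as a map): the head acts first. -/
theorem coe_wordIso_pair (i j : Fin 4) :
    ⇑(wordIso [i, j]) = ⇑(letterIso j) ∘ ⇑(letterIso i) := by
  rw [wordIso_cons, LinearIsometryEquiv.coe_trans, coe_wordIso_singleton]

/-- **The inclined twins of `D₋` as words**: `R_{3+c} (B D) = wordIso [c+1, 0] D` (`= M₀ M_c D`). -/
theorem image_reflectAt_natAdd_basalMirror (c : Fin 3) (D : Set (EuclideanSpace ℝ (Fin 3))) :
    reflectAt (inclinedNormal (Fin.natAdd 3 c)) 0 '' ((basalMirror : EuclideanSpace ℝ (Fin 3) → EuclideanSpace ℝ (Fin 3)) '' D) =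
      wordIso [c.succ, 0] '' D := by
  rw [inclinedNormal_natAdd, ← Set.image_comp, coe_wordIso_pair, ← basalMirror_eq_letterIso, ← reflectAt_inclinedNormal_eq]
  congr 1
  funext x
  exact reflectAt_basalMirror _ x

/-- **THE EIGHT STANDARD PLACEMENTS ARE THE EIGHT PLACEMENT WORDS** `𝒮₀ = {[], [0], [c+1], [c+1, 0] : c = 0,1,2}` (as maps on
the slot dozen: `1, M₀, M_c, M₀M_c`, memo §2(c)): `StdFrame L₀ ↔ L₀ '' fccSlots = wordIso w '' fccSlots` for some `w ∈ 𝒮₀`. -/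
theorem stdFrame_iff_exists_word (L₀ : EuclideanSpace ℝ (Fin 3) ≃ₗᵢ[ℝ] EuclideanSpace ℝ (Fin 3)) :
    StdFrame L₀ ↔ ∃ w : List (Fin 4), (w = [] ∨ w = [0] ∨ ∃ c : Fin 3, w = [c.succ] ∨ w = [c.succ, 0]) ∧
      (L₀ : EuclideanSpace ℝ (Fin 3) → EuclideanSpace ℝ (Fin 3)) '' (↑fccSlots : Set (EuclideanSpace ℝ (Fin 3))) =
        wordIso w '' ↑fccSlots := by
  have h0 : (wordIso [] : EuclideanSpace ℝ (Fin 3) → EuclideanSpace ℝ (Fin 3)) '' (↑fccSlots : Set (EuclideanSpace ℝ (Fin 3))) =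
      ↑fccSlots := by
    rw [wordIso_nil, LinearIsometryEquiv.coe_refl, Set.image_id]
  have h1 : (wordIso [0] : EuclideanSpace ℝ (Fin 3) → EuclideanSpace ℝ (Fin 3)) '' (↑fccSlots : Set (EuclideanSpace ℝ (Fin 3))) =
      (basalMirror : EuclideanSpace ℝ (Fin 3) → EuclideanSpace ℝ (Fin 3)) '' ↑fccSlots := by
    rw [coe_wordIso_singleton, basalMirror_eq_letterIso]
  have h2 : ∀ c : Fin 3, (wordIso [c.succ] : EuclideanSpace ℝ (Fin 3) → EuclideanSpace ℝ (Fin 3)) ''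
      (↑fccSlots : Set (EuclideanSpace ℝ (Fin 3))) = reflectAt (inclinedNormal (Fin.castLE (by norm_num) c)) 0 '' ↑fccSlots := by
    intro c; rw [coe_wordIso_singleton, reflectAt_inclinedNormal_eq]
  constructor
  · rintro (h | h | ⟨c, hc, h⟩ | ⟨c, hc, h⟩)
    · exact ⟨[], Or.inl rfl, by rw [h, h0]⟩
    · exact ⟨[0], Or.inr (Or.inl rfl), by rw [h, h1]⟩
    · have hc' : c = Fin.castLE (by norm_num) (⟨c.val, hc⟩ : Fin 3) := Fin.ext rfl
      refine ⟨[(⟨c.val, hc⟩ : Fin 3).succ], Or.inr (Or.inr ⟨⟨c.val, hc⟩, Or.inl rfl⟩), ?_⟩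
      rw [h, h2, ← hc']
    · have hlt := c.isLt
      have hc' : c = Fin.natAdd 3 (⟨c.val - 3, by omega⟩ : Fin 3) := Fin.ext (by simp; omega)
      refine ⟨[(⟨c.val - 3, by omega⟩ : Fin 3).succ, 0], Or.inr (Or.inr ⟨⟨c.val - 3, by omega⟩, Or.inr rfl⟩), ?_⟩
      rw [h, ← image_reflectAt_natAdd_basalMirror, ← hc']
  · rintro ⟨w, hw, h⟩
    rcases hw with rfl | rfl | ⟨c, rfl | rfl⟩
    · exact Or.inl (by rw [h, h0])
    · exact Or.inr (Or.inl (by rw [h, h1]))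
    · exact Or.inr (Or.inr (Or.inl ⟨Fin.castLE (by norm_num) c, by simp, by rw [h, h2]⟩))
    · exact Or.inr (Or.inr (Or.inr ⟨Fin.natAdd 3 c, by simp, by rw [h, image_reflectAt_natAdd_basalMirror]⟩))


/-! ### The letters as model menu normals; conjugation of letters and words by an isometry -/

/-- Slots pair with the letters in `{0, ±2}` (integer cubic coordinates; kernel table). -/
theorem slot_dot_nrm_cases : ∀ (k : Fin 12) (i : Fin 4),
    slotInt k ⬝ᵥ nrm i = 0 ∨ slotInt k ⬝ᵥ nrm i = 2 ∨ slotInt k ⬝ᵥ nrm i = -2 := by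
  decide

/-- Distinct letters pair to `±1` (integer cubic coordinates; kernel table). -/
theorem nrm_dot_nrm_cases : ∀ i j : Fin 4, i ≠ j → nrm i ⬝ᵥ nrm j = 1 ∨ nrm i ⬝ᵥ nrm j = -1 := by
  decide

/-- `⟪slotSite k, nrmVec i⟫ = (slotInt k ⬝ nrm i)/(√2·√3)`. -/
theorem inner_slotSite_nrmVec (k : Fin 12) (i : Fin 4) :
    ⟪slotSite k, nrmVec i⟫_ℝ = ((slotInt k ⬝ᵥ nrm i : ℤ) : ℝ) / (Real.sqrt 2 * Real.sqrt 3) := by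
  have h2 : Real.sqrt 2 ≠ 0 := by positivity
  have h3 : Real.sqrt 3 ≠ 0 := by positivity
  rw [inner_eq_cubicCoords, cubicCoords_slotSite, cubicCoords_nrmVec, dotProduct_smul, smul_eq_mul]
  simp only [dotProduct, Fin.sum_univ_three, slotVec, nrmR]
  push_cast
  field_simp

/-- `⟪nrmVec i, nrmVec j⟫ = (nrm i ⬝ nrm j)/3`. -/
theorem inner_nrmVec_nrmVec (i j : Fin 4) :
    ⟪nrmVec i, nrmVec j⟫_ℝ = ((nrm i ⬝ᵥ nrm j : ℤ) : ℝ) / 3 := by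
  have h3 : (Real.sqrt 3)⁻¹ * (Real.sqrt 3)⁻¹ = 3⁻¹ := by
    rw [← mul_inv, Real.mul_self_sqrt (by norm_num)]
  rw [inner_eq_cubicCoords, cubicCoords_nrmVec, cubicCoords_nrmVec, dotProduct_smul, smul_dotProduct, smul_eq_mul,
    smul_eq_mul, ← mul_assoc, h3]
  simp only [dotProduct, Fin.sum_univ_three, nrmR]
  push_cast
  ring

/-- **THE LETTERS ARE MODEL MENU NORMALS**: `⟪w, nrmVec i⟫ ∈ {0, ±√(2/3)}` for every slot `w` of `D₊`. -/
theorem nrmVec_menu (i : Fin 4) : ∀ w ∈ fccSlots,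
    ⟪w, nrmVec i⟫_ℝ = 0 ∨ ⟪w, nrmVec i⟫_ℝ = Real.sqrt (2 / 3) ∨ ⟪w, nrmVec i⟫_ℝ = -Real.sqrt (2 / 3) := by
  intro w hw
  obtain ⟨k, rfl⟩ := exists_slotSite_eq hw
  have h2 : Real.sqrt 2 ≠ 0 := by positivity
  have h3 : Real.sqrt 3 ≠ 0 := by positivity
  have hs2 : Real.sqrt 2 * Real.sqrt 2 = 2 := Real.mul_self_sqrt (by norm_num)
  have h23 : Real.sqrt (2 / 3) = 2 / (Real.sqrt 2 * Real.sqrt 3) := by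
    rw [Real.sqrt_div (by norm_num : (0 : ℝ) ≤ 2), div_eq_div_iff h3 (mul_ne_zero h2 h3)]
    linear_combination Real.sqrt 3 * hs2
  rw [inner_slotSite_nrmVec, h23]
  rcases slot_dot_nrm_cases k i with h | h | h <;> rw [h] <;> push_cast
  · exact Or.inl (by simp)
  · exact Or.inr (Or.inl rfl)
  · exact Or.inr (Or.inr (by ring))

/-- The letters are menu normals of the identity frame. -/
theorem isMenuNormal_nrmVec (i : Fin 4) : IsMenuNormal (LinearIsometryEquiv.refl ℝ _) (nrmVec i) :=
  ⟨norm_nrmVec i, fun w hw => by simpa using nrmVec_menu i w hw⟩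

/-- Distinct letters meet at `⟪nᵢ, nⱼ⟫ = ±1/3`. -/
theorem inner_nrmVec_of_ne {i j : Fin 4} (h : i ≠ j) :
    ⟪nrmVec i, nrmVec j⟫_ℝ = 1 / 3 ∨ ⟪nrmVec i, nrmVec j⟫_ℝ = -1 / 3 := by
  rw [inner_nrmVec_nrmVec]
  rcases nrm_dot_nrm_cases i j h with h1 | h1 <;> rw [h1] <;> push_cast
  · exact Or.inl (by ring)
  · exact Or.inr (by ring)

/-- **Conjugating a letter by an isometry**: `O⁻¹ (R_{nᵢ} (O x)) = x − 2⟪x, O⁻¹nᵢ⟫ O⁻¹nᵢ` (the model mirror of the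
pulled-back letter; cf. `basalMirror_map`). -/
theorem symm_letterIso_apply (O : EuclideanSpace ℝ (Fin 3) ≃ₗᵢ[ℝ] EuclideanSpace ℝ (Fin 3)) (i : Fin 4)
    (x : EuclideanSpace ℝ (Fin 3)) :
    O.symm (letterIso i (O x)) = x - (2 * ⟪x, O.symm (nrmVec i)⟫_ℝ) • O.symm (nrmVec i) := by
  have h : ⟪O x, nrmVec i⟫_ℝ = ⟪x, O.symm (nrmVec i)⟫_ℝ := by
    rw [← LinearIsometryEquiv.inner_map_map O x, LinearIsometryEquiv.apply_symm_apply]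
  rw [letterIso_apply, h, map_sub, LinearIsometryEquiv.map_smul, LinearIsometryEquiv.symm_apply_apply]

/-- **Conjugating a word**: `O⁻¹ ∘ wordIso w ∘ O` is the model-side mirror chain of the pulled-back letters
`O⁻¹(nrmVec i)`, in the `foldl` form of `…ReducedWordRigidity` (head letter first). -/
theorem symm_wordIso_apply (O : EuclideanSpace ℝ (Fin 3) ≃ₗᵢ[ℝ] EuclideanSpace ℝ (Fin 3)) (w : List (Fin 4))
    (x : EuclideanSpace ℝ (Fin 3)) :
    O.symm (wordIso w (O x)) =
      (w.map fun i => O.symm (nrmVec i)).foldl (fun (y : EuclideanSpace ℝ (Fin 3)) μ => y - (2 * ⟪y, μ⟫_ℝ) • μ) x := by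
  induction w generalizing x with
  | nil => simp
  | cons i w ih =>
    rw [wordIso_cons, LinearIsometryEquiv.trans_apply, List.map_cons, List.foldl_cons, ← symm_letterIso_apply O i x, ← ih,
      LinearIsometryEquiv.apply_symm_apply]

/-- **Pulled-back letters of a frame stabilising `D₊` are unit model menu normals.** -/
theorem symm_nrmVec_menu (O : EuclideanSpace ℝ (Fin 3) ≃ₗᵢ[ℝ] EuclideanSpace ℝ (Fin 3))
    (hO : (O : EuclideanSpace ℝ (Fin 3) → EuclideanSpace ℝ (Fin 3)) '' (↑fccSlots : Set (EuclideanSpace ℝ (Fin 3))) = ↑fccSlots)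
    (i : Fin 4) :
    ‖O.symm (nrmVec i)‖ = 1 ∧ ∀ w ∈ fccSlots, ⟪w, O.symm (nrmVec i)⟫_ℝ = 0 ∨
      ⟪w, O.symm (nrmVec i)⟫_ℝ = Real.sqrt (2 / 3) ∨ ⟪w, O.symm (nrmVec i)⟫_ℝ = -Real.sqrt (2 / 3) := by
  refine ⟨by rw [LinearIsometryEquiv.norm_map, norm_nrmVec], fun w hw => ?_⟩
  rw [← LinearIsometryEquiv.inner_map_map O w, LinearIsometryEquiv.apply_symm_apply]
  have hOw : O w ∈ (↑fccSlots : Set (EuclideanSpace ℝ (Fin 3))) := hO ▸ Set.mem_image_of_mem _ (Finset.mem_coe.2 hw)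
  exact nrmVec_menu i (O w) (Finset.mem_coe.1 hOw)

/-- The pulled-back letters of a REDUCED word form a reduced model chain (consecutive letters at `±1/3`). -/
theorem isChain_map_symm_nrmVec (O : EuclideanSpace ℝ (Fin 3) ≃ₗᵢ[ℝ] EuclideanSpace ℝ (Fin 3)) {w : List (Fin 4)}
    (hw : w.IsChain (· ≠ ·)) :
    List.IsChain (fun μ μ' : EuclideanSpace ℝ (Fin 3) => ⟪μ, μ'⟫_ℝ = 1 / 3 ∨ ⟪μ, μ'⟫_ℝ = -1 / 3)
      (w.map fun i => O.symm (nrmVec i)) :=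
  List.isChain_map_of_isChain (fun i => O.symm (nrmVec i)) (fun a b (h : a ≠ b) => by
    show ⟪O.symm (nrmVec a), O.symm (nrmVec b)⟫_ℝ = 1 / 3 ∨ ⟪O.symm (nrmVec a), O.symm (nrmVec b)⟫_ℝ = -1 / 3
    rw [LinearIsometryEquiv.inner_map_map]
    exact inner_nrmVec_of_ne h) hw

/-- Reduction does not change the word isometry. -/
theorem wordIso_reduce (w : List (Fin 4)) : wordIso (reduce w) = wordIso w :=
  (wordIso_eq_iff _ _).2 (reduce_eq_self (isChain_reduce w))

/-! ### `std_cases8`: two standard dozens differ by a pulled-back word of length `≤ 3` -/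

/-- The transition words between placement words have normal form of length `≤ 3` (the twin distance inside the
standard family is `≤ 3`; kernel check over the `8 × 8` table). -/
theorem length_reduce_placement {u v : List (Fin 4)}
    (hu : u = [] ∨ u = [0] ∨ ∃ c : Fin 3, u = [c.succ] ∨ u = [c.succ, 0])
    (hv : v = [] ∨ v = [0] ∨ ∃ c : Fin 3, v = [c.succ] ∨ v = [c.succ, 0]) :
    (reduce (v ++ u.reverse)).length ≤ 3 := by
  rcases hu with rfl | rfl | ⟨c, rfl | rfl⟩ <;> rcases hv with rfl | rfl | ⟨c', rfl | rfl⟩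
  all_goals first
    | decide
    | (fin_cases c <;> decide)
    | (fin_cases c' <;> decide)
    | (fin_cases c <;> fin_cases c' <;> decide)

/-- **`std_cases8` (eight standard dozens).**  If `G` and `G'` both have STANDARD slot dozens (`StdFrame`: one of `D₊`,
`D₋`, `R_c D₊` (`c < 3`), `R_c D₋` (`c ≥ 3`)), then the dozen of `G'` is the dozen of `G ∘ Φ_P` for a REDUCED model chain
`P` of at most THREE unit model menu normals (pull-backs through `G` of `{111}` normals), `Φ_P` the mirror chain of
`…ReducedWordRigidity` (head letter first).  The two-dozen case `{D₊, D₋}` is `std_cases` (`P = []` or `[G⁻¹e₃]`). -/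
theorem std_cases8 {G G' : EuclideanSpace ℝ (Fin 3) ≃ₗᵢ[ℝ] EuclideanSpace ℝ (Fin 3)} (hG : StdFrame G) (hG' : StdFrame G') :
    ∃ P : List (EuclideanSpace ℝ (Fin 3)), P.length ≤ 3 ∧
      (∀ p ∈ P, ‖p‖ = 1 ∧
        ∀ w ∈ fccSlots, ⟪w, p⟫_ℝ = 0 ∨ ⟪w, p⟫_ℝ = Real.sqrt (2 / 3) ∨ ⟪w, p⟫_ℝ = -Real.sqrt (2 / 3)) ∧
      List.IsChain (fun μ μ' : EuclideanSpace ℝ (Fin 3) => ⟪μ, μ'⟫_ℝ = 1 / 3 ∨ ⟪μ, μ'⟫_ℝ = -1 / 3) P ∧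
      (G' : EuclideanSpace ℝ (Fin 3) → EuclideanSpace ℝ (Fin 3)) '' (↑fccSlots : Set (EuclideanSpace ℝ (Fin 3))) =
        (G : EuclideanSpace ℝ (Fin 3) → EuclideanSpace ℝ (Fin 3)) ''
          ((fun x => P.foldl (fun (y : EuclideanSpace ℝ (Fin 3)) μ => y - (2 * ⟪y, μ⟫_ℝ) • μ) x) '' ↑fccSlots) := by
  obtain ⟨u, hu, hGu⟩ := (stdFrame_iff_exists_word G).1 hG
  obtain ⟨v, hv, hGv⟩ := (stdFrame_iff_exists_word G').1 hG'
  set O := G.trans (wordIso u).symm with hO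
  have hGO : ∀ y, G (O.symm y) = wordIso u y := by
    intro y
    have h : (G.trans (wordIso u).symm) (O.symm y) = y := O.apply_symm_apply y
    rw [LinearIsometryEquiv.trans_apply] at h
    calc G (O.symm y) = wordIso u ((wordIso u).symm (G (O.symm y))) := ((wordIso u).apply_symm_apply _).symm
      _ = wordIso u y := by rw [h]
  have hOimg : (O : EuclideanSpace ℝ (Fin 3) → EuclideanSpace ℝ (Fin 3)) '' (↑fccSlots : Set (EuclideanSpace ℝ (Fin 3))) =
      ↑fccSlots := by
    rw [hO, LinearIsometryEquiv.coe_trans, Set.image_comp, hGu, ← Set.image_comp]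
    conv_rhs => rw [← Set.image_id (↑fccSlots : Set (EuclideanSpace ℝ (Fin 3)))]
    exact Set.image_congr fun x _ => by simp
  set w := reduce (v ++ u.reverse) with hw
  have hwv : ∀ y, wordIso u (wordIso w y) = wordIso v y := by
    intro y
    rw [hw, wordIso_reduce, wordIso_append, LinearIsometryEquiv.trans_apply, wordIso_reverse,
      LinearIsometryEquiv.apply_symm_apply]
  refine ⟨w.map fun i => O.symm (nrmVec i), by simpa using length_reduce_placement hu hv, fun p hp => ?_,
    isChain_map_symm_nrmVec O (isChain_reduce _), ?_⟩
  · obtain ⟨i, -, rfl⟩ := List.mem_map.1 hp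
    exact symm_nrmVec_menu O hOimg i
  · have hfold : (fun x => (w.map fun i => O.symm (nrmVec i)).foldl
        (fun (y : EuclideanSpace ℝ (Fin 3)) μ => y - (2 * ⟪y, μ⟫_ℝ) • μ) x) = fun x => O.symm (wordIso w (O x)) :=
      funext fun x => (symm_wordIso_apply O w x).symm
    rw [hfold, hGv, Set.image_image]
    have hcomp : (fun x => G (O.symm (wordIso w (O x)))) = fun x => wordIso v (O x) :=
      funext fun x => by rw [hGO, hwv]
    rw [hcomp, (Set.image_image (wordIso v : EuclideanSpace ℝ (Fin 3) → EuclideanSpace ℝ (Fin 3)) O _).symm, hOimg]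

/-- **`std_cases8`, plate-system form.**  For a class `κ₀` (unit letters) whose frame `S.Fw κ₀` is standard and any
standard `G'`: `img G' = img (S.Fw (P ++ κ₀))` with `P` as in `std_cases8` — the eight-dozen analogue of
`std_cases` + `image_basalMirror_fw`, the input of `class_collapse8`. -/
theorem std_cases8_fw (S : PlateSystem) {κ₀ : List (EuclideanSpace ℝ (Fin 3))} (hunit : ∀ μ ∈ κ₀, ‖μ‖ = 1)
    (hstd : StdFrame (S.Fw κ₀)) {G' : EuclideanSpace ℝ (Fin 3) ≃ₗᵢ[ℝ] EuclideanSpace ℝ (Fin 3)} (hG' : StdFrame G') :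
    ∃ P : List (EuclideanSpace ℝ (Fin 3)), P.length ≤ 3 ∧
      (∀ p ∈ P, ‖p‖ = 1 ∧
        ∀ w ∈ fccSlots, ⟪w, p⟫_ℝ = 0 ∨ ⟪w, p⟫_ℝ = Real.sqrt (2 / 3) ∨ ⟪w, p⟫_ℝ = -Real.sqrt (2 / 3)) ∧
      List.IsChain (fun μ μ' : EuclideanSpace ℝ (Fin 3) => ⟪μ, μ'⟫_ℝ = 1 / 3 ∨ ⟪μ, μ'⟫_ℝ = -1 / 3) P ∧
      (G' : EuclideanSpace ℝ (Fin 3) → EuclideanSpace ℝ (Fin 3)) '' (↑fccSlots : Set (EuclideanSpace ℝ (Fin 3))) =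
        (S.Fw (P ++ κ₀) : EuclideanSpace ℝ (Fin 3) → EuclideanSpace ℝ (Fin 3)) '' ↑fccSlots := by
  obtain ⟨P, h1, h2, h3, h4⟩ := std_cases8 hstd hG'
  have hunit' : ∀ μ ∈ P ++ κ₀, ‖μ‖ = 1 := by
    intro μ hμ
    rcases List.mem_append.1 hμ with hμ | hμ
    · exact (h2 μ hμ).1
    · exact hunit μ hμ
  refine ⟨P, h1, h2, h3, ?_⟩
  rw [h4, Set.image_image]
  exact Set.image_congr fun x _ => by rw [fw_apply_eq_foldl S hunit, fw_apply_eq_foldl S hunit', List.foldl_append]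

/-! ### Which normals are menu normals of a standard frame (for the partner letters of `…MirrorPartner`) -/

/-- **The `{111}` normals of a standard dozen are menu normals of its frames**: if `img G = wordIso u '' D₊` then
`wordIso u (nrmVec i)` is a menu normal of `G` (for `u ∈ 𝒮₀` these are `e₃, n_c` and their images `M_b n_c = n_{c+3}`,
`R_c e₃`, …). -/
theorem isMenuNormal_of_image_eq_wordIso {G : EuclideanSpace ℝ (Fin 3) ≃ₗᵢ[ℝ] EuclideanSpace ℝ (Fin 3)} {u : List (Fin 4)}
    (hG : (G : EuclideanSpace ℝ (Fin 3) → EuclideanSpace ℝ (Fin 3)) '' (↑fccSlots : Set (EuclideanSpace ℝ (Fin 3))) =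
      wordIso u '' ↑fccSlots) (i : Fin 4) :
    IsMenuNormal G (wordIso u (nrmVec i)) := by
  refine ⟨by rw [LinearIsometryEquiv.norm_map, norm_nrmVec], fun w hw => ?_⟩
  have hGw : G w ∈ (wordIso u : EuclideanSpace ℝ (Fin 3) → EuclideanSpace ℝ (Fin 3)) '' (↑fccSlots : Set _) :=
    hG ▸ Set.mem_image_of_mem _ (Finset.mem_coe.2 hw)
  obtain ⟨w', hw', hGw'⟩ := hGw
  rw [← hGw', LinearIsometryEquiv.inner_map_map]
  exact nrmVec_menu i w' (Finset.mem_coe.1 hw')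

end ReflWord

end Summit.Ventures.Crystal3D.Theorems

end
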